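import Literature.Probability.RandomPlanarGeometry.HexSAWStripWidthThreeDensity
import HarnessLib

/-!
# The width-three strip: the hat kernel of `S₃` in closed form and the ORDER-FOUR matrix recursion
# `D̂(k+4) = G₃·D̂(k+3) + q·(1 + E′)·D̂(k+1) − q·G₃·D̂(k)` of the hat bridge sums (module «WIDTH-THREE HAT RECURSION»)

Topic `Literature/Probability/RandomPlanarGeometry` (continues «WIDTH-THREE-KERNEL» `HexSAWStripWidthThreeKernel.lean` — the classification of the
irreducible bridges of the honeycomb strip `S₃` (ten short lists + the serpentines `W3.serpUp K : 1 → 5`, `W3.serpDn K : 4 → 0` of length `6K`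
with `K` surface contacts), `W3.kerThree` —, «WIDTH-THREE-DENSITY» `HexSAWStripWidthThreeDensity.lean` — the length slices
`W3.LMset_three_short`, `W3.LMset_three_serp`, the cofactor Perron vector `W3.uThree`, `W3.detThree_stripYT_three`, `W3.sThree` — and
«LENGTH-POINTWISE-LAW» `HexSAWStripBridgeLengthPointwiseLaw.lean` — the hat pair `HV.hatM T y k`, `HV.hatD T y k` (entry `(a,b)` = irreducible /
all standard bridges `a → b` with `2k + χ_a − χ_b` steps, weight `x_c^{#steps} y^{#top}`) and the matrix renewal equation
`HV.hat_ren : D̂(k) = M̂(k) + Σ_{i+j=k} M̂(i)·D̂(j)`; the width-two model is «WIDTH-TWO HAT RECURSION» `HexSAWStripWidthTwoHatRecursion.lean`,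
`W2.hatD_two_succ : D̂(k+1) = G·D̂(k)`).  Lane «pcv-sawmu» (CriticalPhenomena venture), a-p2 g28 — step 1 of the width-three contact-variance
programme (`HOME/pub-sawmu-a-p2/g27/HANDOFF-gen27.md` §Recommended 3: «first the hat recursion of finite order»).  At `T = 3` the hat kernel is NOT
finitely supported — the serpentines give `M̂(3K) = (x⁶y)^K·(E₁₅ + E₄₀)` for every `K ≥ 1` — but its generating function is RATIONAL,
`Σ_k M̂(k)t^k = M̂(0) + M̂(1)t + (E₁₅ + E₄₀)·qt³/(1 − qt³)` with `q = x⁶y`, and multiplying the renewal equation by `1 − qt³` folds the infinite tail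
into a linear recursion of order four with explicit `6 × 6` coefficients.  Sources of the SETTING: H. Duminil-Copin, A. Hammond, CMP 324 (2013)
§2.2 (renewal structure of bridges / irreducible bridges); W. Feller I (1968) XIII.3 (the renewal equation; periodic case); R. P. Stanley, EC1 (2012)
§4.1 Theorem 4.1.1 (rational generating functions ⇔ linear recurrences with constant coefficients); E. Seneta (1973) §1.4 (Perron vectors).
Nothing below is printed.

## What is proved (namespace `Literature.Probability.RandomPlanarGeometry.SAW.HV.W3`; `x = x_c = hexCriticalFugacity`, `q = x⁶y`, levels `0…5`,
## `χ_a = a mod 2`, `E_{ab}` = matrix unit)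

* §1 the LENGTH-GRADED irreducible kernel of `S₃`: `LMM_three_one : LMM 3 1 1 y = lenOneThree y` (five slants of weight `x`, the slant `(4,5)` onto
  the surface of weight `xy`), `LMM_three_two : LMM 3 2 2 y = lenTwoThree` (four rungs, `x²`), ★ `LMM_three_serp : LMM 3 (6K) (6K) y = q^K·(E₁₅+E₄₀)`
  (`K ≥ 1`), `LMM_three_eq_zero` (every other length), `LMM_three_zero`.
* §2 the HAT KERNEL: ★★ `hatM_three_apply` (every entry of `M̂₃(k)` as `[σ=1]M(1) + [σ=2]M(2) + [6∣σ, σ≥6] q^{σ/6}(E₁₅+E₄₀)`, `σ = 2k + χ_a − χ_b`);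
  ★ `hatM_three_zero : M̂(0) = hatMZeroThree` (`(1,0),(3,2),(5,4) = x`), ★ `hatM_three_one : M̂(1) = hatMOneThree y` (`(0,1),(2,3) = x`, `(4,5) = xy`,
  `(0,2),(3,1),(2,4),(5,3) = x²`), ★★ `hatM_three_serp : M̂(3K) = q^K·(E₁₅+E₄₀)` (`K ≥ 1`), ★ `hatM_three_eq_zero : M̂(k) = 0` (`k ≥ 2`, `3 ∤ k`),
  `hatM_three_two_three_four`, ★ `hatM_three_shift : M̂(i+3) = q·M̂(i)` (`i ≥ 2`).
* §3 `hatMZeroThree_mul_self : M̂(0)² = 0`; the explicit one-step matrix ★ `gThree y = (1 + M̂(0))·M̂(1)` (`gThree_eq`) and `ePrimeThree = E₁₅ + E₄₀ + x·E₅₀`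
  with `one_add_ePrimeThree_eq : 1 + E′ = (1 + M̂(0))(1 + E₁₅ + E₄₀ − M̂(0))`; ★★★ **`hatD_three_rec (hy : 0 ≤ y) (hk : 1 ≤ k) :
  hatD 3 y (k+4) = gThree y * hatD 3 y (k+3) + q • ((1 + ePrimeThree) * hatD 3 y (k+1)) − q • (gThree y * hatD 3 y k)`** — every hat bridge sum of the
  width-three honeycomb strip, at every surface fugacity `y ≥ 0`, obeys ONE linear recursion of order four with constant `6 × 6` matrix coefficients
  (the threshold `k ≥ 1` is sharp: at `k = 0` the inhomogeneity `−q·G₃` of the renewal equation survives).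
* §4 `kerThree_eq_hat : K₃(s;y) = M̂(0) + M̂(1) + s·(E₁₅+E₄₀)`; `recSymbolOne_eq`; ★ `recSymbolOne_mulVec_of_fixed` (`K₃(s;y)u = u`, `s(1−q) = q` ⇒
  `(G₃ + q(1+E′) − qG₃)u = u`); ★★ `recSymbolOne_mulVec_uThree` — at `(x_c, y₃)` the symbol of the recursion at `λ = 1` fixes the cofactor Perron vector
  `u₃` of «WIDTH-THREE-DENSITY»: `λ = 1` is a characteristic root of the recursion at criticality, with the known eigenvector.

Label: LANE THEOREM (own result of lane «pcv-sawmu», a-p2 g28, 2026-08-28; not in print).  NOT claimed: the companion (first-order, `24 × 24`) form and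
its spectral decomposition, the localisation of the other characteristic roots inside the unit disc, the rate of `D̂(k) → A`, the contact recursions
(`Ĉ`, `Ĉ²`) and the variance rate `σ₃²` — the next cars of the programme; any `T ≥ 4`.
-/

noncomputable section

open Finset Filter Topology Matrix Literature.Probability.LatticeModels Literature.Probability.Percolation

namespace Literature.Probability.RandomPlanarGeometry.SAW

namespace HV

namespace W3

/-! ## §1 The length-graded irreducible kernel of `S₃` and the hat kernel `M̂₃(k)` -/

/-- The one-step part `M(1)(y)` of the irreducible kernel of `S₃`: the five slants `(0,1),(1,0),(2,3),(3,2),(5,4)` of weight `x` and the slant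
`(4,5)` onto the surface of weight `x·y`. [cite: DuminilCopinHammond2013, §2.2 (irreducible bridges); lane «pcv-sawmu» a-p2 g28] -/
def lenOneThree (y : ℝ) : Matrix (Fin (2 * 3)) (Fin (2 * 3)) ℝ :=
  Matrix.of ![![0, hexCriticalFugacity, 0, 0, 0, 0], ![hexCriticalFugacity, 0, 0, 0, 0, 0], ![0, 0, 0, hexCriticalFugacity, 0, 0],
    ![0, 0, hexCriticalFugacity, 0, 0, 0], ![0, 0, 0, 0, 0, hexCriticalFugacity * y], ![0, 0, 0, 0, hexCriticalFugacity, 0]]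

/-- The two-step part `M(2)` of the irreducible kernel of `S₃`: the four rung lists `(0,2),(3,1),(2,4),(5,3)`, weight `x²`, no contact.
[cite: DuminilCopinHammond2013, §2.2; lane «pcv-sawmu» a-p2 g28] -/
def lenTwoThree : Matrix (Fin (2 * 3)) (Fin (2 * 3)) ℝ :=
  Matrix.of ![![0, 0, hexCriticalFugacity ^ 2, 0, 0, 0], ![0, 0, 0, 0, 0, 0], ![0, 0, 0, 0, hexCriticalFugacity ^ 2, 0],
    ![0, hexCriticalFugacity ^ 2, 0, 0, 0, 0], ![0, 0, 0, 0, 0, 0], ![0, 0, 0, hexCriticalFugacity ^ 2, 0, 0]]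

/-- The serpentine pattern `E₁₅ + E₄₀` (the two level pairs carrying the serpentines `serpUp K : 1 → 5`, `serpDn K : 4 → 0`).
[cite: DuminilCopinHammond2013, §2.2; lane «pcv-sawmu» a-p2 g28] -/
def eSerpThree : Matrix (Fin (2 * 3)) (Fin (2 * 3)) ℝ :=
  Matrix.of ![![0, 0, 0, 0, 0, 0], ![0, 0, 0, 0, 0, 1], ![0, 0, 0, 0, 0, 0], ![0, 0, 0, 0, 0, 0], ![1, 0, 0, 0, 0, 0], ![0, 0, 0, 0, 0, 0]]

/-- ★ `LMM 3 1 1 y = M(1)(y)`: the one-step irreducible bridges of `S₃`. [cite: DuminilCopinHammond2013, §2.2; lane «pcv-sawmu» a-p2 g28] -/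
theorem LMM_three_one (y : ℝ) : LMM 3 1 (1 : ℕ) y = lenOneThree y := by
  have S := LMset_three_short 1
  have P := LMset_three_serp 1
  have hE := fun {a b : ℤ} (h) => LMset_of_empty_class (a := a) (b := b) (fun N => HBk_three_empty (N := N) h) 1
  obtain ⟨w01, w10, w23, w32, w54, w45, w02, w31, w24, w53⟩ := wD_irr y
  norm_num at S P hE
  ext a b
  fin_cases a <;> fin_cases b <;>
    simp [lenOneThree, LMM, LMs, S.1, S.2.1, S.2.2.1, S.2.2.2.1, S.2.2.2.2.1, S.2.2.2.2.2.1, S.2.2.2.2.2.2.1, S.2.2.2.2.2.2.2.1,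
      S.2.2.2.2.2.2.2.2.1, S.2.2.2.2.2.2.2.2.2, P.1, P.2, w01, w10, w23, w32, w54, w45, hE]

/-- ★ `LMM 3 2 2 y = M(2)`: the two-step irreducible bridges of `S₃`. [cite: DuminilCopinHammond2013, §2.2; lane «pcv-sawmu» a-p2 g28] -/
theorem LMM_three_two (y : ℝ) : LMM 3 2 (2 : ℕ) y = lenTwoThree := by
  have S := LMset_three_short 2
  have P := LMset_three_serp 2
  have hE := fun {a b : ℤ} (h) => LMset_of_empty_class (a := a) (b := b) (fun N => HBk_three_empty (N := N) h) 2
  obtain ⟨w01, w10, w23, w32, w54, w45, w02, w31, w24, w53⟩ := wD_irr y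
  norm_num at S P hE
  ext a b
  fin_cases a <;> fin_cases b <;>
    simp [lenTwoThree, LMM, LMs, S.1, S.2.1, S.2.2.1, S.2.2.2.1, S.2.2.2.2.1, S.2.2.2.2.2.1, S.2.2.2.2.2.2.1, S.2.2.2.2.2.2.2.1,
      S.2.2.2.2.2.2.2.2.1, S.2.2.2.2.2.2.2.2.2, P.1, P.2, w02, w31, w24, w53, hE]

/-- ★ `LMM 3 (6K) (6K) y = (x⁶y)^K · (E₁₅ + E₄₀)` for `K ≥ 1`: the serpentine slices. [cite: DuminilCopinHammond2013, §2.2; lane «pcv-sawmu» a-p2 g28] -/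
theorem LMM_three_serp (y : ℝ) {K : ℕ} (hK : 1 ≤ K) :
    LMM 3 (6 * K) ((6 * K : ℕ) : ℤ) y = (hexCriticalFugacity ^ 6 * y) ^ K • eSerpThree := by
  have S := LMset_three_short (6 * K)
  have P := LMset_three_serp (6 * K)
  have hE := fun {a b : ℤ} (h) => LMset_of_empty_class (a := a) (b := b) (fun N => HBk_three_empty (N := N) h) (6 * K)
  have h6 : (6 ∣ 6 * K ∧ 6 ≤ 6 * K) := ⟨⟨K, rfl⟩, by omega⟩
  have hK6 : 6 * K / 6 = K := by omega
  have hne1 : 6 * K ≠ 1 := by omega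
  have hne2 : 6 * K ≠ 2 := by omega
  have wU := wD_serpUp K y
  have wDn := wD_serpDn K y
  simp only [hne1, hne2, h6, hK6, if_false, Nat.cast_mul, Nat.cast_ofNat] at S P hE
  push_cast
  ext a b
  fin_cases a <;> fin_cases b <;>
    simp [eSerpThree, LMM, LMs, S.1, S.2.1, S.2.2.1, S.2.2.2.1, S.2.2.2.2.1, S.2.2.2.2.2.1, S.2.2.2.2.2.2.1, S.2.2.2.2.2.2.2.1,
      S.2.2.2.2.2.2.2.2.1, S.2.2.2.2.2.2.2.2.2, P.1, P.2, hE, wU, wDn, mul_pow, pow_mul]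

/-- ★ `LMM 3 n n y = 0` for every length `n ∉ {1, 2} ∪ 6ℕ_{≥1}`: no irreducible bridge of `S₃` has such a length.
[cite: DuminilCopinHammond2013, §2.2; lane «pcv-sawmu» a-p2 g28] -/
theorem LMM_three_eq_zero (y : ℝ) {n : ℕ} (h1 : n ≠ 1) (h2 : n ≠ 2) (h6 : ¬ (6 ∣ n ∧ 6 ≤ n)) : LMM 3 n (n : ℤ) y = 0 := by
  have S := LMset_three_short n
  have P := LMset_three_serp n
  have hE := fun {a b : ℤ} (h) => LMset_of_empty_class (a := a) (b := b) (fun N => HBk_three_empty (N := N) h) n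
  simp only [h1, h2, h6, if_false] at S P
  ext a b
  fin_cases a <;> fin_cases b <;>
    simp [LMM, LMs, S.1, S.2.1, S.2.2.1, S.2.2.2.1, S.2.2.2.2.1, S.2.2.2.2.2.1, S.2.2.2.2.2.2.1, S.2.2.2.2.2.2.2.1,
      S.2.2.2.2.2.2.2.2.1, S.2.2.2.2.2.2.2.2.2, P.1, P.2, hE]

/-- `LMM 3 0 0 y = 0` (no irreducible bridge has zero steps; plumbing). [cite: DuminilCopinHammond2013, §2.2; lane plumbing] -/
theorem LMM_three_zero (y : ℝ) : LMM 3 0 (0 : ℕ) y = 0 := by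
  ext a b
  exact LMM_eq_zero_of_le (by norm_num) y a b

/-! ## §2 The hat kernel `M̂₃(k)` of `S₃` in closed form -/

/-- The hat kernel of `S₃` at hat index `0`: the three slants `(1,0)`, `(3,2)`, `(5,4)` (odd level to the even level below, length `1 = χ_a − χ_b`),
weight `x`. [cite: DuminilCopinHammond2013, §2.2; Feller1968, XIII.3; lane «pcv-sawmu» a-p2 g28] -/
def hatMZeroThree : Matrix (Fin (2 * 3)) (Fin (2 * 3)) ℝ :=
  Matrix.of ![![0, 0, 0, 0, 0, 0], ![hexCriticalFugacity, 0, 0, 0, 0, 0], ![0, 0, 0, 0, 0, 0], ![0, 0, hexCriticalFugacity, 0, 0, 0],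
    ![0, 0, 0, 0, 0, 0], ![0, 0, 0, 0, hexCriticalFugacity, 0]]

/-- The hat kernel of `S₃` at hat index `1`: the slants `(0,1)`, `(2,3)` (weight `x`), `(4,5)` (weight `x·y`, the surface contact) of length
`1 = 2 + χ_a − χ_b`, and the four rungs `(0,2)`, `(3,1)`, `(2,4)`, `(5,3)` (weight `x²`, length `2`). [cite: DuminilCopinHammond2013, §2.2; Feller1968, XIII.3; lane «pcv-sawmu» a-p2 g28] -/
def hatMOneThree (y : ℝ) : Matrix (Fin (2 * 3)) (Fin (2 * 3)) ℝ :=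
  Matrix.of ![![0, hexCriticalFugacity, hexCriticalFugacity ^ 2, 0, 0, 0], ![0, 0, 0, 0, 0, 0],
    ![0, 0, 0, hexCriticalFugacity, hexCriticalFugacity ^ 2, 0], ![0, hexCriticalFugacity ^ 2, 0, 0, 0, 0],
    ![0, 0, 0, 0, 0, hexCriticalFugacity * y], ![0, 0, 0, hexCriticalFugacity ^ 2, 0, 0]]

/-- ★★ **The hat kernel of `S₃`, every entry**: with `σ = 2k + χ_a − χ_b`, `M̂₃(k)_{ab} = [σ = 1]·M(1)_{ab} + [σ = 2]·M(2)_{ab} + [6 ∣ σ, σ ≥ 6]·(x⁶y)^{σ/6}·(E₁₅ + E₄₀)_{ab}`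
(truncation independence + the length-graded kernel of §1). [cite: DuminilCopinHammond2013, §2.2; Feller1968, XIII.3; lane «pcv-sawmu» a-p2 g28 — own] -/
theorem hatM_three_apply (y : ℝ) (k : ℕ) (a b : Fin (2 * 3)) :
    hatM 3 y k a b = (if hatLen k a b = 1 then lenOneThree y a b else 0) + (if hatLen k a b = 2 then lenTwoThree a b else 0) +
      (if 6 ∣ hatLen k a b ∧ 6 ≤ hatLen k a b then (hexCriticalFugacity ^ 6 * y) ^ ((hatLen k a b).toNat / 6) * eSerpThree a b else 0) := by
  have hχa := (lchi_facts a).1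
  have hχb := (lchi_facts b).1
  have hσN : hatLen k a b ≤ ((2 * k + 1 : ℕ) : ℤ) := by unfold hatLen; push_cast; omega
  rw [hatM]
  by_cases h0 : hatLen k a b ≤ 0
  · rw [LMM_eq_zero_of_le h0 y a b, if_neg (by omega), if_neg (by omega), if_neg (by omega)]; ring
  · obtain ⟨n, hn⟩ : ∃ n : ℕ, hatLen k a b = (n : ℤ) := ⟨(hatLen k a b).toNat, (Int.toNat_of_nonneg (by omega)).symm⟩
    have h := (LUM_LMM_eq_of_le (T := 3) (σ := hatLen k a b) (N := 2 * k + 1) (N' := n) hσN (by omega) y).2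
    rw [h, hn, Int.toNat_natCast]
    by_cases h1 : n = 1
    · subst h1; rw [LMM_three_one]; norm_num
    by_cases h2 : n = 2
    · subst h2; rw [LMM_three_two]; norm_num
    by_cases h6 : 6 ∣ n ∧ 6 ≤ n
    · obtain ⟨⟨K, rfl⟩, h6'⟩ := h6
      have hK : 1 ≤ K := by omega
      rw [LMM_three_serp y hK, if_neg (by omega), if_neg (by omega),
        if_pos ⟨by push_cast; exact Dvd.intro _ rfl, by push_cast; omega⟩, Nat.mul_div_cancel_left _ (by norm_num)]
      simp [Matrix.smul_apply]
    · rw [LMM_three_eq_zero y h1 h2 h6, if_neg (by omega), if_neg (by omega), if_neg]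
      · simp
      · rintro ⟨hd, hle⟩
        exact h6 ⟨by exact_mod_cast hd, by exact_mod_cast hle⟩

/-- The serpentine pattern vanishes between levels of different parity (plumbing). [cite: DuminilCopinHammond2013, §2.2; lane plumbing] -/
theorem eSerpThree_eq_zero_of_ne {a b : Fin (2 * 3)} (h : lchi a ≠ lchi b) : eSerpThree a b = 0 := by
  fin_cases a <;> fin_cases b <;> simp [lchi, eSerpThree] at h ⊢

/-- ★ `M̂₃(0) = hatMZeroThree`. [cite: DuminilCopinHammond2013, §2.2; Feller1968, XIII.3; lane «pcv-sawmu» a-p2 g28] -/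
theorem hatM_three_zero (y : ℝ) : hatM 3 y 0 = hatMZeroThree := by
  ext a b
  rw [hatM_three_apply]
  fin_cases a <;> fin_cases b <;> norm_num [hatLen, lchi, hatMZeroThree, lenOneThree, lenTwoThree, eSerpThree]

/-- ★ `M̂₃(1) = hatMOneThree y`. [cite: DuminilCopinHammond2013, §2.2; Feller1968, XIII.3; lane «pcv-sawmu» a-p2 g28] -/
theorem hatM_three_one (y : ℝ) : hatM 3 y 1 = hatMOneThree y := by
  ext a b
  rw [hatM_three_apply]
  fin_cases a <;> fin_cases b <;> norm_num [hatLen, lchi, hatMOneThree, lenOneThree, lenTwoThree, eSerpThree]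

/-- ★★ **`M̂₃(3K) = (x⁶y)^K · (E₁₅ + E₄₀)` for `K ≥ 1`**: the serpentines `serpUp K : 1 → 5`, `serpDn K : 4 → 0` (length `6K`, `K` contacts) are the
only irreducible bridges of `S₃` of hat index `3K`. [cite: DuminilCopinHammond2013, §2.2; lane «pcv-sawmu» a-p2 g28 — own] -/
theorem hatM_three_serp (y : ℝ) {K : ℕ} (hK : 1 ≤ K) : hatM 3 y (3 * K) = (hexCriticalFugacity ^ 6 * y) ^ K • eSerpThree := by
  ext a b
  have hχa := (lchi_facts a).1
  have hχb := (lchi_facts b).1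
  rw [hatM_three_apply, Matrix.smul_apply, smul_eq_mul, if_neg (by unfold hatLen; push_cast; omega),
    if_neg (by unfold hatLen; push_cast; omega), zero_add, zero_add]
  by_cases hab : lchi a = lchi b
  · have hσ : hatLen (3 * K) a b = 6 * (K : ℤ) := by unfold hatLen; push_cast; omega
    rw [hσ, if_pos ⟨Dvd.intro _ rfl, by omega⟩]
    congr 2
    omega
  · rw [eSerpThree_eq_zero_of_ne hab, mul_zero, if_neg]
    · simp
    · rintro ⟨hd, -⟩
      unfold hatLen at hd
      omega

/-- ★ `M̂₃(k) = 0` for every `k ≥ 2` not divisible by `3` (no irreducible bridge of `S₃` has `2k + χ_a − χ_b` steps then).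
[cite: DuminilCopinHammond2013, §2.2; lane «pcv-sawmu» a-p2 g28] -/
theorem hatM_three_eq_zero (y : ℝ) {k : ℕ} (hk : 2 ≤ k) (h3 : ¬ 3 ∣ k) : hatM 3 y k = 0 := by
  ext a b
  have hχa := (lchi_facts a).1
  have hχb := (lchi_facts b).1
  rw [hatM_three_apply, Matrix.zero_apply, if_neg (by unfold hatLen; omega), if_neg (by unfold hatLen; omega), if_neg]
  · simp
  · rintro ⟨hd, -⟩
    unfold hatLen at hd
    omega

/-- `M̂₃(2) = 0`, `M̂₃(3) = x⁶y · (E₁₅ + E₄₀)`, `M̂₃(4) = 0` (the instances used by the recursion). [cite: DuminilCopinHammond2013, §2.2; lane plumbing] -/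
theorem hatM_three_two_three_four (y : ℝ) :
    hatM 3 y 2 = 0 ∧ hatM 3 y 3 = (hexCriticalFugacity ^ 6 * y) • eSerpThree ∧ hatM 3 y 4 = 0 := by
  refine ⟨hatM_three_eq_zero y le_rfl (by norm_num), ?_, hatM_three_eq_zero y (by norm_num) (by norm_num)⟩
  have h := hatM_three_serp y (K := 1) le_rfl
  rw [mul_one, pow_one] at h
  exact h

/-- ★ **The serpentine shift**: `M̂₃(i + 3) = x⁶y · M̂₃(i)` for every `i ≥ 2` (the hat kernel is geometric along the serpentine classes and zero
elsewhere beyond index `1`). [cite: DuminilCopinHammond2013, §2.2; Stanley2012EC1, §4.1 Theorem 4.1.1; lane «pcv-sawmu» a-p2 g28 — own] -/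
theorem hatM_three_shift (y : ℝ) {i : ℕ} (hi : 2 ≤ i) : hatM 3 y (i + 3) = (hexCriticalFugacity ^ 6 * y) • hatM 3 y i := by
  by_cases h3 : 3 ∣ i
  · obtain ⟨K, rfl⟩ := h3
    have hK : 1 ≤ K := by omega
    rw [show 3 * K + 3 = 3 * (K + 1) by ring, hatM_three_serp y (by omega : 1 ≤ K + 1), hatM_three_serp y hK, smul_smul, pow_succ]
    congr 1
    ring
  · rw [hatM_three_eq_zero y hi h3, hatM_three_eq_zero y (by omega) (by omega), smul_zero]

/-! ## §3 `M̂₃(0)² = 0`, the one-step matrix `G₃ = (1 + M̂₃(0))·M̂₃(1)`, and the ORDER-FOUR recursion -/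

/-- ★ **The one-step hat transfer matrix of `S₃`**: `G₃(y) = (1 + M̂(0))·M̂(1) =
(0,x,x²,0,0,0 | 0,x²,x³,0,0,0 | 0,0,0,x,x²,0 | 0,x²,0,x²,x³,0 | 0,0,0,0,0,xy | 0,0,0,x²,0,x²y)`.
[cite: Feller1968, XIII.3; Stanley2012EC1, §4.1 Theorem 4.1.1; lane «pcv-sawmu» a-p2 g28 — own] -/
def gThree (y : ℝ) : Matrix (Fin (2 * 3)) (Fin (2 * 3)) ℝ :=
  Matrix.of ![![0, hexCriticalFugacity, hexCriticalFugacity ^ 2, 0, 0, 0], ![0, hexCriticalFugacity ^ 2, hexCriticalFugacity ^ 3, 0, 0, 0],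
    ![0, 0, 0, hexCriticalFugacity, hexCriticalFugacity ^ 2, 0], ![0, hexCriticalFugacity ^ 2, 0, hexCriticalFugacity ^ 2, hexCriticalFugacity ^ 3, 0],
    ![0, 0, 0, 0, 0, hexCriticalFugacity * y], ![0, 0, 0, hexCriticalFugacity ^ 2, 0, hexCriticalFugacity ^ 2 * y]]

/-- The delayed-feedback pattern `E′ = E₁₅ + E₄₀ + x·E₅₀ = (1 + M̂(0))·(1 + E₁₅ + E₄₀ − M̂(0)) − 1` of the recursion's third-order term.
[cite: Feller1968, XIII.3; lane «pcv-sawmu» a-p2 g28 — own] -/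
def ePrimeThree : Matrix (Fin (2 * 3)) (Fin (2 * 3)) ℝ :=
  Matrix.of ![![0, 0, 0, 0, 0, 0], ![0, 0, 0, 0, 0, 1], ![0, 0, 0, 0, 0, 0], ![0, 0, 0, 0, 0, 0], ![1, 0, 0, 0, 0, 0],
    ![hexCriticalFugacity, 0, 0, 0, 0, 0]]

/-- `M̂₃(0)² = 0` (two odd-to-even slants never compose). [cite: DuminilCopinHammond2013, §2.2; lane plumbing] -/
theorem hatMZeroThree_mul_self : hatMZeroThree * hatMZeroThree = 0 := by
  ext a b
  fin_cases a <;> fin_cases b <;> simp [hatMZeroThree, Matrix.mul_apply, Fin.sum_univ_succ]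

/-- `G₃ = (1 + M̂(0))·M̂(1)`. [cite: Feller1968, XIII.3; lane «pcv-sawmu» a-p2 g28] -/
theorem gThree_eq (y : ℝ) : gThree y = (1 + hatMZeroThree) * hatMOneThree y := by
  ext a b
  fin_cases a <;> fin_cases b <;>
    simp [gThree, hatMZeroThree, hatMOneThree, Matrix.mul_apply, Matrix.add_apply, Fin.sum_univ_succ, Matrix.one_apply] <;> ring

/-- `1 + E′ = (1 + M̂(0))·(1 + E₁₅ + E₄₀ − M̂(0))`. [cite: Feller1968, XIII.3; lane «pcv-sawmu» a-p2 g28] -/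
theorem one_add_ePrimeThree_eq : (1 : Matrix (Fin (2 * 3)) (Fin (2 * 3)) ℝ) + ePrimeThree = (1 + hatMZeroThree) * (1 + eSerpThree - hatMZeroThree) := by
  ext a b
  fin_cases a <;> fin_cases b <;>
    simp [ePrimeThree, hatMZeroThree, eSerpThree, Matrix.mul_apply, Matrix.add_apply, Matrix.sub_apply, Fin.sum_univ_succ, Matrix.one_apply]

/-- ★★★ **The hat bridge sums of the width-three strip obey an ORDER-FOUR linear recursion with explicit matrix coefficients**: for every `k ≥ 1` and
`0 ≤ y`, with `q = x⁶y`,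
`D̂(k+4) = G₃·D̂(k+3) + q·(1 + E′)·D̂(k+1) − q·G₃·D̂(k)`.
Proof: the renewal equation `hat_ren` at index `k+4`, minus `q` times the one at `k+1`, kills the infinite serpentine tail (`M̂(i+3) = q·M̂(i)` for
`i ≥ 2`) and leaves `(1 − M̂(0))·D̂(k+4) = M̂(1)·D̂(k+3) + q·(1 + E₁₅ + E₄₀ − M̂(0))·D̂(k+1) − q·M̂(1)·D̂(k)`; multiply by `1 + M̂(0) = (1 − M̂(0))⁻¹`.
The serpentine kernel of `S₃` is not finitely supported, but it is RATIONAL in the hat variable (`Σ_k M̂(k)t^k = M̂(0) + M̂(1)t + (E₁₅+E₄₀)·qt³/(1 − qt³)`),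
and this is the finite recursion that rationality buys (the width-two analogue `D̂(k+1) = G·D̂(k)` is «WIDTH-TWO HAT RECURSION»).
[cite: Feller1968, XIII.3 (renewal equation); Stanley2012EC1, §4.1 Theorem 4.1.1 (rational ⇔ linear recurrence); DuminilCopinHammond2013, §2.2; lane «pcv-sawmu» a-p2 g28 — own result, not in print] -/
theorem hatD_three_rec {y : ℝ} (hy : 0 ≤ y) {k : ℕ} (hk : 1 ≤ k) :
    hatD 3 y (k + 4) = gThree y * hatD 3 y (k + 3) + (hexCriticalFugacity ^ 6 * y) • ((1 + ePrimeThree) * hatD 3 y (k + 1))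
      - (hexCriticalFugacity ^ 6 * y) • (gThree y * hatD 3 y k) := by
  obtain ⟨m, rfl⟩ : ∃ m, k = m + 1 := ⟨k - 1, by omega⟩
  obtain ⟨hM2, hM3, hM4⟩ := hatM_three_two_three_four y
  set q : ℝ := hexCriticalFugacity ^ 6 * y with hq
  -- the renewal equation at `m + 5`, three + two terms peeled off the antidiagonal
  have hren5 := hat_ren (T := 3) hy (m + 5)
  rw [Finset.Nat.sum_antidiagonal_succ, Finset.Nat.sum_antidiagonal_succ, Finset.Nat.sum_antidiagonal_succ, Finset.Nat.sum_antidiagonal_succ,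
    Finset.Nat.sum_antidiagonal_succ] at hren5
  -- the renewal equation at `m + 2`, two terms peeled
  have hren2 := hat_ren (T := 3) hy (m + 2)
  rw [Finset.Nat.sum_antidiagonal_succ, Finset.Nat.sum_antidiagonal_succ] at hren2
  simp only [zero_add] at hren5 hren2
  -- the serpentine shift inside the tail sum and at the top
  have htail : ∑ p ∈ antidiagonal m, hatM 3 y (p.1 + 1 + 1 + 1 + 1 + 1) * hatD 3 y p.2 =
      q • ∑ p ∈ antidiagonal m, hatM 3 y (p.1 + 1 + 1) * hatD 3 y p.2 := by
    rw [Finset.smul_sum]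
    refine Finset.sum_congr rfl fun p _ => ?_
    rw [show p.1 + 1 + 1 + 1 + 1 + 1 = (p.1 + 2) + 3 by ring, hatM_three_shift y (by omega), Matrix.smul_mul, show p.1 + 1 + 1 = p.1 + 2 by ring]
  have htop : hatM 3 y (m + 5) = q • hatM 3 y (m + 2) := by
    rw [show m + 5 = (m + 2) + 3 by ring]; exact hatM_three_shift y (by omega)
  rw [htail, htop, hatM_three_zero, hatM_three_one, hM2, hM3, hM4, Matrix.zero_mul, zero_add, Matrix.zero_mul, zero_add,
    Matrix.smul_mul, show m + 4 + 1 = m + 5 from rfl, show m + 3 + 1 = m + 4 from rfl, show m + 1 + 1 = m + 2 from rfl] at hren5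
  rw [hatM_three_zero, hatM_three_one] at hren2
  -- `q ×` the renewal equation at `m + 2`, solved for the tail sum (the index form `m + 1 + 1` is kept on purpose)
  have h2q : q • hatM 3 y (m + 2) + q • ∑ p ∈ antidiagonal m, hatM 3 y (p.1 + 1 + 1) * hatD 3 y p.2 =
      q • hatD 3 y (m + 2) - q • (hatMZeroThree * hatD 3 y (m + 1 + 1)) - q • (hatMOneThree y * hatD 3 y (m + 1)) := by
    have h : q • hatD 3 y (m + 2) = q • (hatM 3 y (m + 2) + (hatMZeroThree * hatD 3 y (m + 1 + 1) +
        (hatMOneThree y * hatD 3 y (m + 1) + ∑ p ∈ antidiagonal m, hatM 3 y (p.1 + 1 + 1) * hatD 3 y p.2))) := by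
      rw [← hren2]
    rw [h, smul_add, smul_add, smul_add]; abel
  -- hren5 minus q · hren2 determines D(m+5) − M̂0·D(m+5)
  have hR : hatD 3 y (m + 5) - hatMZeroThree * hatD 3 y (m + 5) =
      hatMOneThree y * hatD 3 y (m + 4) + q • (eSerpThree * hatD 3 y (m + 2)) + q • hatD 3 y (m + 2)
        - q • (hatMZeroThree * hatD 3 y (m + 1 + 1)) - q • (hatMOneThree y * hatD 3 y (m + 1)) := by
    calc hatD 3 y (m + 5) - hatMZeroThree * hatD 3 y (m + 5)
        = (q • hatM 3 y (m + 2) + (hatMZeroThree * hatD 3 y (m + 5) + (hatMOneThree y * hatD 3 y (m + 4) +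
            (q • (eSerpThree * hatD 3 y (m + 2)) + q • ∑ p ∈ antidiagonal m, hatM 3 y (p.1 + 1 + 1) * hatD 3 y p.2))))
            - hatMZeroThree * hatD 3 y (m + 5) := by rw [← hren5]
      _ = hatMOneThree y * hatD 3 y (m + 4) + q • (eSerpThree * hatD 3 y (m + 2))
            + (q • hatM 3 y (m + 2) + q • ∑ p ∈ antidiagonal m, hatM 3 y (p.1 + 1 + 1) * hatD 3 y p.2) := by abel
      _ = _ := by rw [h2q]; abel
  rw [show m + 1 + 1 = m + 2 from rfl] at hR
  -- multiply by `1 + M̂0 = (1 − M̂0)⁻¹`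
  have key : (1 + hatMZeroThree) * (hatD 3 y (m + 5) - hatMZeroThree * hatD 3 y (m + 5)) = hatD 3 y (m + 5) := by
    rw [Matrix.mul_sub, Matrix.add_mul, Matrix.one_mul, Matrix.add_mul, Matrix.one_mul, ← Matrix.mul_assoc, hatMZeroThree_mul_self,
      Matrix.zero_mul]
    abel
  rw [show m + 1 + 4 = m + 5 from rfl, show m + 1 + 3 = m + 4 from rfl, show m + 1 + 1 = m + 2 from rfl, ← key, hR, gThree_eq,
    one_add_ePrimeThree_eq]
  simp only [Matrix.mul_add, Matrix.mul_sub, Matrix.mul_smul, Matrix.sub_mul, Matrix.add_mul, Matrix.one_mul, Matrix.mul_assoc, smul_add,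
    smul_sub]
  abel

/-! ## §4 The kernel through its hat pieces, and the symbol of the recursion at `λ = 1` fixes the critical Perron vector -/

/-- `K₃(s; y) = M̂(0) + M̂(1) + s·(E₁₅ + E₄₀)`: the kernel of «WIDTH-THREE-KERNEL» regrouped by hat index (`s` = the serpentine series).
[cite: DuminilCopinHammond2013, §2.2; lane «pcv-sawmu» a-p2 g28] -/
theorem kerThree_eq_hat (s y : ℝ) : kerThree s y = hatMZeroThree + hatMOneThree y + s • eSerpThree := by
  ext a b
  fin_cases a <;> fin_cases b <;> simp [kerThree, hatMZeroThree, hatMOneThree, eSerpThree, Matrix.add_apply]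

/-- The symbol of the recursion at `λ = 1` factors through `1 + M̂(0)`: `G₃ + q(1 + E′) − qG₃ = (1 + M̂(0))·((1 − q)M̂(1) + q(1 + E₁₅ + E₄₀ − M̂(0)))`.
[cite: Stanley2012EC1, §4.1 Theorem 4.1.1; lane «pcv-sawmu» a-p2 g28] -/
theorem recSymbolOne_eq (y q : ℝ) :
    gThree y + q • (1 + ePrimeThree) - q • gThree y =
      (1 + hatMZeroThree) * ((1 - q) • hatMOneThree y + q • (1 + eSerpThree - hatMZeroThree)) := by
  rw [gThree_eq, one_add_ePrimeThree_eq, Matrix.mul_add, Matrix.mul_smul, Matrix.mul_smul, sub_smul, one_smul]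
  abel

/-- ★ **`λ = 1` is an eigenvalue of the recursion's symbol whenever `K₃` has a fixed vector**: if `K₃(s; y)u = u` and `s(1 − q) = q` (i.e. `s` is the
serpentine series `q/(1 − q)`), then `(G₃ + q(1 + E′) − qG₃)u = u` — the order-four recursion is consistent with the critical renewal structure
(`1 = G₃ + q(1+E′) − qG₃` on `u` is `λ⁴ = G₃λ³ + q(1+E′)λ − qG₃` at `λ = 1`). [cite: Seneta1973, §1.4 (Perron vectors); Feller1968, XIII.3; lane «pcv-sawmu» a-p2 g28 — own] -/
theorem recSymbolOne_mulVec_of_fixed {s y q : ℝ} {u : Fin (2 * 3) → ℝ} (hu : kerThree s y *ᵥ u = u) (hs : s * (1 - q) = q) :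
    (gThree y + q • (1 + ePrimeThree) - q • gThree y) *ᵥ u = u := by
  rw [kerThree_eq_hat, Matrix.add_mulVec, Matrix.add_mulVec, Matrix.smul_mulVec] at hu
  -- `M̂(1)u = u − M̂(0)u − s·Eu`
  have hb : hatMOneThree y *ᵥ u = u - hatMZeroThree *ᵥ u - s • (eSerpThree *ᵥ u) := by
    calc hatMOneThree y *ᵥ u
        = (hatMZeroThree *ᵥ u + hatMOneThree y *ᵥ u + s • eSerpThree *ᵥ u) - hatMZeroThree *ᵥ u - s • (eSerpThree *ᵥ u) := by abel
      _ = u - hatMZeroThree *ᵥ u - s • (eSerpThree *ᵥ u) := by rw [hu]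
  -- the inner factor sends `u` to `u − M̂(0)u`
  have hX : ((1 - q) • hatMOneThree y + q • (1 + eSerpThree - hatMZeroThree)) *ᵥ u = u - hatMZeroThree *ᵥ u := by
    rw [Matrix.add_mulVec, Matrix.smul_mulVec, Matrix.smul_mulVec, Matrix.sub_mulVec, Matrix.add_mulVec, Matrix.one_mulVec, hb]
    ext i
    simp only [Pi.add_apply, Pi.smul_apply, Pi.sub_apply, smul_eq_mul]
    linear_combination (-(eSerpThree *ᵥ u) i) * hs
  have hM0 : hatMZeroThree *ᵥ (hatMZeroThree *ᵥ u) = 0 := by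
    rw [Matrix.mulVec_mulVec, hatMZeroThree_mul_self, Matrix.zero_mulVec]
  rw [recSymbolOne_eq, ← Matrix.mulVec_mulVec, hX, Matrix.add_mulVec, Matrix.one_mulVec, Matrix.mulVec_sub, hM0, sub_zero, sub_add_cancel]

/-- `s₃(1 − q₃) = q₃` with `q₃ = x⁶y₃` (the serpentine series at criticality; plumbing). [cite: DuminilCopinHammond2013, §2.2; lane plumbing] -/
theorem sThree_mul_one_sub : sThree * (1 - hexCriticalFugacity ^ 6 * stripYT 3) = hexCriticalFugacity ^ 6 * stripYT 3 := by
  have hq : hexCriticalFugacity ^ 6 * stripYT 3 < 1 := xc_pow_six_mul_stripYT_three_lt_one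
  rw [sThree, div_mul_cancel₀ _ (by linarith)]

/-- ★★ **At criticality the recursion's symbol at `λ = 1` fixes the Perron vector of `S₃`**: with `y₃ = stripYT 3`, `q₃ = x⁶y₃`, `u₃ = uThree s₃ y₃`
(the cofactor Perron vector of «WIDTH-THREE-DENSITY»), `(G₃(y₃) + q₃(1 + E′) − q₃G₃(y₃))·u₃ = u₃` — the constant sequence `u₃` solves the
order-four recursion, as the limit `D̂(k) → A` of the next cars must. [cite: Seneta1973, §1.4; Feller1968, XIII.3; lane «pcv-sawmu» a-p2 g28 — own] -/
theorem recSymbolOne_mulVec_uThree :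
    (gThree (stripYT 3) + (hexCriticalFugacity ^ 6 * stripYT 3) • (1 + ePrimeThree) - (hexCriticalFugacity ^ 6 * stripYT 3) • gThree (stripYT 3)) *ᵥ
        uThree sThree (stripYT 3) = uThree sThree (stripYT 3) :=
  recSymbolOne_mulVec_of_fixed (kerThree_mulVec_uThree detThree_stripYT_three) sThree_mul_one_sub

end W3

end HV

end Literature.Probability.RandomPlanarGeometry.SAW
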